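import Summits.CriticalPhenomena.PercolationContinuityZ3.Theorems.PercNearOneGluingNoHeavyLowerTailKNGoodGMgcFourSide
import HarnessLib

/-!
# `NoHeavyLowerTail` (stmt-CriticalPhenomena-4575) — EVERY separated quadruple with three relays and an observer side of at
# most four vertices is good (one statement)

Support file (`--supports stmt-CriticalPhenomena-4575`, hull-port prover `prim-hp-2`, gen 20).  No definitions, no named facts, no
sorries.

Kozma–Nitzan (arXiv:2401.12397, §3.2 p. 12) call a quadruple `(G, A, 0, b)` — `0` and `b` in different components of `G ∖ A` — GOOD if
`P(0 ↔ b) ≥ min_a P(a ↔ b) − Σ_{W ∩ A = ∅} P(C(0) = W) · min_a P_{G∖W}(a ↔ b)`; they prove it for one-layer observers (Theorem 4) and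
chains (Theorem 5).  The tree proves it for EVERY observer side when `|A| = 2` (`KNGoodTwoRelays.knGood_two_relays`) and, for
`|A| = 3`, for the sides `{o, x, y}` (`KNGoodGC3Adj.knGood_twoChildren_threeRelays`, GC₃) and `{o, x, y, z}`
(`KNGoodGMgc.knGood_threeChildren`, THEOREM B + the blob kernel).  This file packages these as ONE theorem over an arbitrary observer
side:

* `KNGoodSideFour.knGood_congr_offDiag` — goodness does not see loop weights (all events in the definition are determined by the
  non-diagonal pairs); removes the hypothesis `w s(o,o) = 0` of `knGood_threeChildren`.
* `KNGoodSideFour.knGood_threeRelays_side_le_four` — **let `A = {a₁, a₂, a₃}` and let `VB ∋ o` be a set of at most four vertices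
  missing `A` and `b` such that every pair from `VB` to a vertex outside `VB ∪ A` has weight zero (removing `A` separates `o` from `b`).
  Then `(G, A, o, b)` is good.**  Cases `|VB| = 1, 2, 3, 4` = Theorem 4, Theorem 5 (chain), `knGood_twoChildren_threeRelays`,
  `knGood_threeChildren`.
* `KNGoodSideFour.knGood_threeRelays_side_le_four'` — the same with the separation phrased by `KNSep.sideB / sideT` as in
  `knGood_two_relays`.

[cite: KozmaNitzan2024, §3.2 Definition and Thms. 4–5 (pp. 12–14), Lemma 5 (p. 13)]
-/

noncomputable section

namespace Summit.CriticalPhenomena.PercolationContinuityZ3.Theorems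

open MeasureTheory Set Literature.Probability.LatticeModels Literature.Probability.Percolation KNGoodAux
open scoped Classical BigOperators

variable {n : ℕ}

namespace KNGoodSideFour

/-! ### Goodness ignores loops -/

/-- `{o ↔ v}` is determined by the non-diagonal pairs. [folklore] -/
theorem determinedBy_openConn_wireSet (o v : Fin n) :
    DeterminedBy (openConn o v : Set (BondConfig (Fin n))) (wireSet (univ : Set (Fin n))) := by
  rw [← KozmaNitzan.openConnIn_univ_eq' o v]
  exact KozmaNitzan.determinedBy_openConnIn_wireSet univ o v subset_rfl

/-- `{C(o) = W}` is determined by the non-diagonal pairs. [folklore] -/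
theorem determinedBy_clusterIs_wireSet (o : Fin n) (W : Finset (Fin n)) :
    DeterminedBy (clusterIs o W) (wireSet (univ : Set (Fin n))) := by
  have h : clusterIs o W = (⋂ v ∈ (↑W : Set (Fin n)), (openConn o v : Set (BondConfig (Fin n)))) ∩
      ⋂ v ∈ (↑W : Set (Fin n))ᶜ, (openConn o v : Set (BondConfig (Fin n)))ᶜ := by
    ext ω
    simp only [mem_clusterIs, mem_inter_iff, mem_iInter, mem_compl_iff, Finset.mem_coe, Set.ext_iff]
    constructor
    · intro hW
      exact ⟨fun v hv => (hW v).2 hv, fun v hv hc => hv ((hW v).1 hc)⟩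
    · rintro ⟨h1, h2⟩ v
      exact ⟨fun hv => by_contra fun hvW => h2 v hvW hv, fun hv => h1 v hv⟩
  rw [h]
  refine DeterminedBy.inter ?_ ?_
  · exact DeterminedBy.iInter fun v => DeterminedBy.iInter fun _ => determinedBy_openConn_wireSet o v
  · exact DeterminedBy.iInter fun v => DeterminedBy.iInter fun _ => (determinedBy_openConn_wireSet o v).compl

/-- `{a ↔ b off W}` is determined by the non-diagonal pairs. [folklore] -/
theorem determinedBy_openConnIn_wireSet_univ (S : Set (Fin n)) (a b : Fin n) :
    DeterminedBy (openConnIn S a b : Set (BondConfig (Fin n))) (wireSet (univ : Set (Fin n))) :=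
  KozmaNitzan.determinedBy_openConnIn_wireSet S a b fun _ he => ⟨fun x _ => mem_univ x, he.2⟩

/-- **Goodness does not see loop weights**: weight functions agreeing off the diagonal define the same good quadruples (every
event in the definition — `{a ↔ b}`, `{C(o) = W}`, `{a ↔ b off W}` — is determined by the non-diagonal pairs).
[cite: KozmaNitzan2024, §3.2 Definition (p. 12)] -/
theorem knGood_congr_offDiag (w w' : Sym2 (Fin n) → unitInterval) (h : ∀ f : Sym2 (Fin n), ¬f.IsDiag → w f = w' f)
    (A : Finset (Fin n)) (hA : A.Nonempty) (o b : Fin n) : KNGood w A hA o b ↔ KNGood w' A hA o b := by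
  have hF : ∀ f ∈ wireSet (univ : Set (Fin n)), w f = w' f := fun f hf => h f hf.2
  have h1 : ∀ a : Fin n, (prodBernoulli w).real (openConn a b) = (prodBernoulli w').real (openConn a b) := fun a =>
    prodBernoulli_real_eq_of_determinedBy w w' hF (determinedBy_openConn_wireSet a b) MeasurableSet.of_discrete
  have h2 : ∀ W : Finset (Fin n), (prodBernoulli w).real (clusterIs o W) = (prodBernoulli w').real (clusterIs o W) := fun W =>
    prodBernoulli_real_eq_of_determinedBy w w' hF (determinedBy_clusterIs_wireSet o W) MeasurableSet.of_discrete
  have h3 : ∀ (W : Finset (Fin n)) (a : Fin n), (prodBernoulli w).real (openConnIn ((↑W : Set (Fin n))ᶜ) a b) =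
      (prodBernoulli w').real (openConnIn ((↑W : Set (Fin n))ᶜ) a b) := fun W a =>
    prodBernoulli_real_eq_of_determinedBy w w' hF (determinedBy_openConnIn_wireSet_univ _ a b) MeasurableSet.of_discrete
  unfold KNGood
  simp only [h1, h2, h3]

/-- Killing all loops: the weight function that is `0` on the diagonal and `w` elsewhere. [folklore] -/
theorem knGood_iff_killLoops (w : Sym2 (Fin n) → unitInterval) (A : Finset (Fin n)) (hA : A.Nonempty) (o b : Fin n) :
    KNGood w A hA o b ↔ KNGood (fun f => if f.IsDiag then 0 else w f) A hA o b :=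
  knGood_congr_offDiag w _ (fun f hf => by rw [if_neg hf]) A hA o b

/-! ### The wrapper -/

/-- **EVERY SEPARATED QUADRUPLE WITH THREE RELAYS AND AN OBSERVER SIDE OF AT MOST FOUR VERTICES IS GOOD.**  Let `A = {a₁, a₂, a₃}`
(distinct) and let `VB` be a set of at most four vertices containing the observer `o` and missing `A` and `b`, such that every pair
joining a vertex of `VB` to a vertex outside `VB ∪ A` has weight zero (so removing `A` separates `o` from `b`; the pairs inside
`VB`, from `VB` to `A`, and all pairs off `VB` are arbitrary).  Then `(G, A, o, b)` is good in the sense of Kozma–Nitzan §3.2.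
Cases: `VB = {o}` — Theorem 4; `{o, x}` — Theorem 5 (chain); `{o, x, y}` — `KNGoodGC3Adj.knGood_twoChildren_threeRelays` (GC₃);
`{o, x, y, z}` — `KNGoodGMgc.knGood_threeChildren` (THEOREM B + blob kernel), after killing loops (`knGood_congr_offDiag`).
[cite: KozmaNitzan2024, §3.2 Definition and Thms. 4–5 (pp. 12–14), Lemma 5 (p. 13)] -/
theorem knGood_threeRelays_side_le_four (w : Sym2 (Fin n) → unitInterval) (VB : Finset (Fin n)) (o b a₁ a₂ a₃ : Fin n)
    (h12 : a₁ ≠ a₂) (h13 : a₁ ≠ a₃) (h23 : a₂ ≠ a₃) (ho : o ∈ VB) (ha₁ : a₁ ∉ VB) (ha₂ : a₂ ∉ VB) (ha₃ : a₃ ∉ VB)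
    (hb : b ∉ VB) (hcard : VB.card ≤ 4)
    (hcut : ∀ p ∈ VB, ∀ q : Fin n, q ∉ VB → q ∉ ({a₁, a₂, a₃} : Finset (Fin n)) → w s(p, q) = 0) :
    KNGood w ({a₁, a₂, a₃} : Finset (Fin n)) (Finset.insert_nonempty a₁ {a₂, a₃}) o b := by
  set A : Finset (Fin n) := {a₁, a₂, a₃} with hAdef
  have hA : A.Nonempty := Finset.insert_nonempty a₁ {a₂, a₃}
  -- members of `VB` are not relays
  have hVA : ∀ p ∈ VB, p ∉ A := by
    intro p hp hpA
    rw [hAdef, Finset.mem_insert, Finset.mem_insert, Finset.mem_singleton] at hpA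
    rcases hpA with rfl | rfl | rfl
    · exact ha₁ hp
    · exact ha₂ hp
    · exact ha₃ hp
  have hoA : o ∉ A := hVA o ho
  have hbo : b ≠ o := fun h => hb (h ▸ ho)
  -- kill the loops
  set w' : Sym2 (Fin n) → unitInterval := fun f => if f.IsDiag then 0 else w f with hw'
  rw [knGood_iff_killLoops w A hA o b]
  have hdiag : ∀ p : Fin n, w' s(p, p) = 0 := fun p => by rw [hw']; simp
  have hcut' : ∀ p ∈ VB, ∀ q : Fin n, q ∉ VB → q ∉ A → w' s(p, q) = 0 := by
    intro p hp q hq hqA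
    rw [hw']; simp only
    split_ifs
    · rfl
    · exact hcut p hp q hq hqA
  -- a pair at `p ∈ VB` towards `q` vanishes unless `q ∈ VB ∖ {p}` or `q ∈ A`
  have hzero : ∀ p ∈ VB, ∀ q : Fin n, q ∉ A → (q ∈ VB → q = p) → w' s(p, q) = 0 := by
    intro p hp q hqA hq
    by_cases hqV : q ∈ VB
    · rw [hq hqV]; exact hdiag p
    · exact hcut' p hp q hqV hqA
  -- the other vertices of the side
  set S : Finset (Fin n) := VB.erase o with hS
  have hScard : S.card ≤ 3 := by
    have := Finset.card_erase_of_mem ho; rw [← hS] at this; omega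
  have hVB : VB = insert o S := by rw [hS, Finset.insert_erase ho]
  have hoS : o ∉ S := by rw [hS]; exact Finset.notMem_erase o VB
  have hmemVB : ∀ q : Fin n, q ∈ VB ↔ q = o ∨ q ∈ S := fun q => by rw [hVB, Finset.mem_insert]
  -- case split on `|S|`
  rcases Nat.lt_or_ge S.card 1 with h0 | h1
  · -- `S = ∅`: Theorem 4
    have hS0' : S.card = 0 := by omega
    have hS0 : S = ∅ := Finset.card_eq_zero.1 hS0'
    refine KozmaNitzan2024_thm4_good w' A hA o b hoA fun u huo huA => hzero o ho u huA fun huV => ?_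
    rcases (hmemVB u).1 huV with h | h
    · exact h
    · rw [hS0] at h; exact absurd h (Finset.notMem_empty u)
  rcases Nat.lt_or_ge S.card 2 with h1' | h2
  · -- `S = {x}`: Theorem 5 (chain)
    have hS1 : S.card = 1 := by omega
    obtain ⟨x, hSx⟩ := Finset.card_eq_one.1 hS1
    have hxS : x ∈ S := by rw [hSx]; exact Finset.mem_singleton_self x
    have hxV : x ∈ VB := (hmemVB x).2 (Or.inr hxS)
    have hxo : x ≠ o := fun h => hoS (h ▸ hxS)
    refine KozmaNitzan2024_thm5_chain w' A hA o b x hoA hbo (hVA x hxV) hxo (fun u huo huA hux => hzero o ho u huA fun huV => ?_)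
      (fun u hux huA huo => hzero x hxV u huA fun huV => ?_)
    · rcases (hmemVB u).1 huV with h | h
      · exact absurd h huo
      · rw [hSx, Finset.mem_singleton] at h; exact absurd h hux
    · rcases (hmemVB u).1 huV with h | h
      · exact absurd h huo
      · rw [hSx, Finset.mem_singleton] at h; exact absurd h hux
  rcases Nat.lt_or_ge S.card 3 with h2' | h3
  · -- `S = {x, y}`: two children over three relays
    have hS2 : S.card = 2 := by omega
    obtain ⟨x, y, hxy, hSxy⟩ := Finset.card_eq_two.1 hS2
    have hxS : x ∈ S := by rw [hSxy]; simp
    have hyS : y ∈ S := by rw [hSxy]; simp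
    have hxV : x ∈ VB := (hmemVB x).2 (Or.inr hxS)
    have hyV : y ∈ VB := (hmemVB y).2 (Or.inr hyS)
    have hxo : x ≠ o := fun h => hoS (h ▸ hxS)
    have hyo : y ≠ o := fun h => hoS (h ▸ hyS)
    have hmemS : ∀ q : Fin n, q ∈ S ↔ q = x ∨ q = y := fun q => by rw [hSxy, Finset.mem_insert, Finset.mem_singleton]
    refine KNGoodGC3Adj.knGood_twoChildren_threeRelays w' A hA o x y b a₁ a₂ a₃ rfl h12 h13 h23 hoA (hVA x hxV) (hVA y hyV)
      hxo hyo hxy hbo (fun h => hb (h ▸ hxV)) (fun h => hb (h ▸ hyV)) ?_ ?_ ?_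
    · intro v hvo hvA hvx hvy
      refine hzero o ho v hvA fun hvV => ?_
      rcases (hmemVB v).1 hvV with h | h
      · exact h
      · rcases (hmemS v).1 h with h' | h'
        · exact absurd h' hvx
        · exact absurd h' hvy
    · intro t htA hto hty
      refine hzero x hxV t htA fun htV => ?_
      rcases (hmemVB t).1 htV with h | h
      · exact absurd h hto
      · rcases (hmemS t).1 h with h' | h'
        · exact h'
        · exact absurd h' hty
    · intro t htA hto htx
      refine hzero y hyV t htA fun htV => ?_
      rcases (hmemVB t).1 htV with h | h
      · exact absurd h hto
      · rcases (hmemS t).1 h with h' | h'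
        · exact absurd h' htx
        · exact h'
  · -- `S = {x, y, z}`: three children
    have hS3 : S.card = 3 := le_antisymm hScard h3
    obtain ⟨x, y, z, hxy, hxz, hyz, hSxyz⟩ := Finset.card_eq_three.1 hS3
    have hxS : x ∈ S := by rw [hSxyz]; simp
    have hyS : y ∈ S := by rw [hSxyz]; simp
    have hzS : z ∈ S := by rw [hSxyz]; simp
    have hxV : x ∈ VB := (hmemVB x).2 (Or.inr hxS)
    have hyV : y ∈ VB := (hmemVB y).2 (Or.inr hyS)
    have hzV : z ∈ VB := (hmemVB z).2 (Or.inr hzS)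
    have hxo : x ≠ o := fun h => hoS (h ▸ hxS)
    have hyo : y ≠ o := fun h => hoS (h ▸ hyS)
    have hzo : z ≠ o := fun h => hoS (h ▸ hzS)
    have hmemS : ∀ q : Fin n, q ∈ S ↔ q = x ∨ q = y ∨ q = z := fun q => by
      rw [hSxyz, Finset.mem_insert, Finset.mem_insert, Finset.mem_singleton]
    refine KNGoodGMgc.knGood_threeChildren w' A hA o x y z b a₁ a₂ a₃ rfl h12 h13 h23 hoA (hVA x hxV) (hVA y hyV) (hVA z hzV)
      hxo hyo hzo hxy hxz hyz hbo (fun h => hb (h ▸ hxV)) (fun h => hb (h ▸ hyV)) (fun h => hb (h ▸ hzV)) (hdiag o) ?_ ?_ ?_ ?_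
    · intro v hvo hvA hvx hvy hvz
      refine hzero o ho v hvA fun hvV => ?_
      rcases (hmemVB v).1 hvV with h | h
      · exact h
      · rcases (hmemS v).1 h with h' | h' | h'
        · exact absurd h' hvx
        · exact absurd h' hvy
        · exact absurd h' hvz
    · intro t htA hto hty htz
      refine hzero x hxV t htA fun htV => ?_
      rcases (hmemVB t).1 htV with h | h
      · exact absurd h hto
      · rcases (hmemS t).1 h with h' | h' | h'
        · exact h'
        · exact absurd h' hty
        · exact absurd h' htz
    · intro t htA hto htx htz
      refine hzero y hyV t htA fun htV => ?_
      rcases (hmemVB t).1 htV with h | h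
      · exact absurd h hto
      · rcases (hmemS t).1 h with h' | h' | h'
        · exact absurd h' htx
        · exact h'
        · exact absurd h' htz
    · intro t htA hto htx hty
      refine hzero z hzV t htA fun htV => ?_
      rcases (hmemVB t).1 htV with h | h
      · exact absurd h hto
      · rcases (hmemS t).1 h with h' | h' | h'
        · exact absurd h' htx
        · exact absurd h' hty
        · exact h'

open KNSep in
/-- The same corollary with the separation phrased as in `KNGoodTwoRelays.knGood_two_relays`: no pair outside both
`KNSep.sideB ↑VB ↑A` (pairs inside `VB ∪ A`) and `KNSep.sideT ↑VB ↑A` (pairs off `VB`, not inside `A`) has positive weight.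
[cite: KozmaNitzan2024, §3.2 Definition and Thms. 4–5 (pp. 12–14)] -/
theorem knGood_threeRelays_side_le_four' (w : Sym2 (Fin n) → unitInterval) (VB : Finset (Fin n)) (o b a₁ a₂ a₃ : Fin n)
    (h12 : a₁ ≠ a₂) (h13 : a₁ ≠ a₃) (h23 : a₂ ≠ a₃) (ho : o ∈ VB) (ha₁ : a₁ ∉ VB) (ha₂ : a₂ ∉ VB) (ha₃ : a₃ ∉ VB)
    (hb : b ∉ VB) (hcard : VB.card ≤ 4)
    (hcut : ∀ e, e ∉ sideB (↑VB : Set (Fin n)) ({a₁, a₂, a₃} : Set (Fin n)) →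
      e ∉ sideT (↑VB : Set (Fin n)) ({a₁, a₂, a₃} : Set (Fin n)) → w e = 0) :
    KNGood w ({a₁, a₂, a₃} : Finset (Fin n)) (Finset.insert_nonempty a₁ {a₂, a₃}) o b := by
  refine knGood_threeRelays_side_le_four w VB o b a₁ a₂ a₃ h12 h13 h23 ho ha₁ ha₂ ha₃ hb hcard fun p hp q hqV hqA => hcut _ ?_ ?_
  · intro he
    have hq := he q (Sym2.mem_mk_right p q)
    rcases hq with hq | hq
    · exact hqV (Finset.mem_coe.1 hq)
    · refine hqA ?_
      rw [Finset.mem_insert, Finset.mem_insert, Finset.mem_singleton]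
      simpa [Set.mem_insert_iff, Set.mem_singleton_iff] using hq
  · intro he
    exact he.1 p (Sym2.mem_mk_left p q) (Finset.mem_coe.2 hp)

end KNGoodSideFour

end Summit.CriticalPhenomena.PercolationContinuityZ3.Theorems

end
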